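import Literature.Analysis.FluidPDE.ParabolicLocalEstimates
import Literature.Analysis.FluidPDE.DriftHeatMassChain
import HarnessLib

/-!
# Proof of Lieberman's weak Harnack inequality (Corollary 6.24, `σ = 1`) for
# `uₜ + a·∇u − Δu = 0` with bounded measurable drift

Analysis/FluidPDE proofs file (theorems only): the discharge
`Lieberman1996_weak_harnack_holds` of the named fact
`Literature.Analysis.FluidPDE.Lieberman1996_weak_harnack` of `ParabolicLocalEstimates`
(sibling of `ParabolicLocalEstimatesProofs`, which discharges Theorem 6.17 by the same
comparison machinery)
(Lieberman 1996, Ch. VI, Corollary 6.24, in the vendored rendering: linear equation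
`uₜ + a·∇u − Δu = 0`, drift `‖a‖ ≤ A` jointly measurable, solutions in the elementary
time-integrated class of `KNSS2009_lemma21`, `σ = 1`, `θ₁ + θ₃ ≤ 1`).

The printed proof is Moser's iteration (Lieberman §VI.6, Lemmata 6.19–6.21). Here the
principal part is the Laplacian and the solutions are classical in space, so the `L¹` weak
Harnack inequality follows from **Gaussian comparison** (support files
`DriftHeatKernelLowerBound`, `DriftHeatKernelWindow`, `DriftHeatMassChain`, built on the
drift-robust kernels `DriftHeatKernel`, the kernel barriers `DriftHeatKernelBarrier`, the
comparison principle `DriftHeatLocalComparison` and the caloric approximate identity of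
`HeatKernelHeatEquation`):

* `setIntegral_ball_le_sum_of_cover` — `∫_{B} f ≤ Σ_p ∫_{B_p} f` for a finite cover by balls on
  which `f ≥ 0`;
* `IsDriftHeatSolutionOn.chain_step` — one step of the chain of infima with the uniform
  constant `Λ = c₀ |B(0,1)| 8⁻ⁿ` of the positivity window (`exists_kernel_window`, `inf_step`);
* `IsDriftHeatSolutionOn.mass_le_of_chain` — the mass of `u(τ, ·)` on a small ball
  `B(c_p, ρ/8)` is at most `ρⁿ/(c₀Λᴺ) · u(t, x)` (`mass_to_pointwise` for a first step of age
  `κ₁ρ²`, then `chain_lower_bound` along the segment from `c_p` to `x`, which stays in the convex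
  base `B(y₀, 4R)` of the cylinder `Q` where `u ≥ 0`);
* `Lieberman1996_weak_harnack_holds` — choice of the constants
  (`c = min(θ₃, θ₄/2)`, `ρ = cR`, window `[κ₁, κs]` from `exists_kernel_window` at `ρ₀ = cR₀`
  and drift bound `max A 0`, `N = ⌈max(32/c, 32/(κs c²))⌉` steps, a finite net `P` of the unit
  ball at scale `c/(8θ₂)`), the cover of `B(y₂, θ₂R)` by the balls `B(y₂ + θ₂R p, ρ/8)`,
  summation, and Fubini in the time variable:
  `R^{-n-2} ∫_{Q(Y₂,θ₂R)} u ≤ θ₂² |P| cⁿ/(c₀Λᴺ) · u(t,x) ≤ C (u(t,x) + kR)` with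
  `C = θ₂² |P| cⁿ/(c₀Λᴺ) + 1`, uniform in `R ≤ R₀`, the drift, the solution and `k > 0`.

## References

* G. M. Lieberman, *Second Order Parabolic Differential Equations*, World Scientific (1996),
  Ch. VI §6 (6.32), Theorem 6.18, Corollary 6.24 (p. 127); §7 Theorem 6.25. [Lieberman1996]
* J. Moser, *A Harnack inequality for parabolic differential equations*, Comm. Pure Appl.
  Math. 17 (1964) 101–134 (the original chain argument).
-/

noncomputable section

open MeasureTheory Set Function Filter Metric Real InnerProductSpace Topology
open scoped Laplacian

namespace Literature.Analysis.FluidPDE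

variable {E : Type*} [NormedAddCommGroup E] [InnerProductSpace ℝ E] [FiniteDimensional ℝ E]
  [MeasurableSpace E] [BorelSpace E]

/-! ### Summing over a finite cover of a ball -/

section CoverSum

/-- If the balls `B(c_p, r')`, `p ∈ P`, cover `B(y, r)` and `f ≥ 0` on each of them, then
`∫_{B(y,r)} f ≤ Σ_p ∫_{B(c_p, r')} f`. [folklore] -/
theorem setIntegral_ball_le_sum_of_cover {f : E → ℝ} {y : E} {r r' : ℝ} {P : Finset E}
    {cen : E → E} (hcov : ∀ z ∈ ball y r, ∃ p ∈ P, z ∈ ball (cen p) r')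
    (hnonneg : ∀ p ∈ P, ∀ z ∈ ball (cen p) r', 0 ≤ f z)
    (hint : ∀ p ∈ P, IntegrableOn f (ball (cen p) r') volume)
    (hint0 : IntegrableOn f (ball y r) volume) :
    ∫ z in ball y r, f z ≤ ∑ p ∈ P, ∫ z in ball (cen p) r', f z := by
  have hsum : (∫ z, ∑ p ∈ P, (ball (cen p) r').indicator f z) =
      ∑ p ∈ P, ∫ z in ball (cen p) r', f z := by
    rw [integral_finsetSum _ (fun p hp => (hint p hp).integrable_indicator measurableSet_ball)]
    exact Finset.sum_congr rfl fun p _ => integral_indicator measurableSet_ball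
  rw [← hsum, ← integral_indicator measurableSet_ball]
  refine integral_mono (hint0.integrable_indicator measurableSet_ball)
    (integrable_finsetSum _ fun p hp => (hint p hp).integrable_indicator measurableSet_ball)
    fun z => ?_
  have hnn : ∀ q ∈ P, 0 ≤ (ball (cen q) r').indicator f z := fun q hq =>
    Set.indicator_nonneg (fun w hw => hnonneg q hq w hw) z
  by_cases hz : z ∈ ball y r
  · obtain ⟨p, hp, hzp⟩ := hcov z hz
    rw [indicator_of_mem hz]
    calc f z = (ball (cen p) r').indicator f z := by rw [indicator_of_mem hzp]
      _ ≤ ∑ q ∈ P, (ball (cen q) r').indicator f z :=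
        Finset.single_le_sum (f := fun q => (ball (cen q) r').indicator f z) hnn hp
  · rw [indicator_of_notMem hz]
    exact Finset.sum_nonneg hnn

end CoverSum

/-! ### The chain step and the mass bound for one small ball -/

section MassChain

variable {a : ℝ → E → E} {u : ℝ → E → ℝ} {A T : ℝ} {Ω : Set E}

/-- **The chain step from the positivity window.** For a member of the local class on
`(0, T] × Ω` that is nonnegative on `I × V` (`I ⊆ (0, T]` an interval, `V ⊆ Ω`), radii
`ρ ≤ ρ₀` and a window `[κ₁, κs]` (`2nκs ≤ 9/32`) on which `ρ'ⁿ · profile ≥ c₀`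
(`exists_kernel_window`): a lower bound `μ ≥ 0` of `u(τ₁, ·)` on `B̄(z, ρ/8)` gives the lower
bound `c₀ |B(0,1)| 8⁻ⁿ μ` of `u(τ₂, ·)` on `B̄(z, 3ρ/8)` whenever `B̄(z, ρ) ⊆ V`, `τ₁, τ₂ ∈ I`,
`κ₁ρ² ≤ τ₂ − τ₁ ≤ κsρ²` (`inf_step`). [cite: Lieberman1996, Ch. VI Thm 6.18, Cor 6.24 (Gaussian-comparison proof of the lower bound)] -/
theorem IsDriftHeatSolutionOn.chain_step (hw : IsDriftHeatSolutionOn a u A (Ioc 0 T) Ω)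
    (hΩ : IsOpen Ω) (hA : 0 ≤ A) {V : Set E} {I : Set ℝ} (hVΩ : V ⊆ Ω) (hIT : I ⊆ Ioc 0 T)
    (hIo : I.OrdConnected) (hpos : ∀ τ ∈ I, ∀ z ∈ V, 0 ≤ u τ z) {ρ ρ₀ κ₁ κs c₀ : ℝ}
    (hρ : 0 < ρ) (hρ₀ : ρ ≤ ρ₀) (hκ₁ : 0 < κ₁)
    (hκsN : 2 * (Module.finrank ℝ E : ℝ) * κs ≤ 9 / 32)
    (hc₀ : ∀ ρ' ∈ Ioc 0 ρ₀, ∀ κ ∈ Icc κ₁ κs, c₀ ≤ ρ' ^ Module.finrank ℝ E *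
      (kSubLow (Module.finrank ℝ E) A (5 / 8 * ρ') (κ * ρ' ^ 2) -
        gaussTail (Module.finrank ℝ E) (3 / 4 * ρ') (κ * ρ' ^ 2))) :
    ∀ (z : E) (τ₁ τ₂ : ℝ), closedBall z ρ ⊆ V → τ₁ ∈ I → τ₂ ∈ I →
      κ₁ * ρ ^ 2 ≤ τ₂ - τ₁ → τ₂ - τ₁ ≤ κs * ρ ^ 2 → ∀ μ : ℝ, 0 ≤ μ →
      (∀ y ∈ closedBall z (ρ / 8), μ ≤ u τ₁ y) →
        ∀ y ∈ closedBall z (3 / 8 * ρ),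
          c₀ * (volume (ball (0 : E) 1)).toReal * (1 / 8) ^ Module.finrank ℝ E * μ ≤ u τ₂ y := by
  intro z τ₁ τ₂ hzV hτ₁ hτ₂ hlo hhi μ hμ hμu y hy
  set Nd : ℕ := Module.finrank ℝ E with hNd
  have hn0 : (0 : ℝ) ≤ (Nd : ℝ) := Nat.cast_nonneg _
  have hρ2 : 0 < ρ ^ 2 := by positivity
  have hτ12 : τ₁ < τ₂ := by
    have := mul_pos hκ₁ hρ2
    linarith
  have hS' : Icc τ₁ τ₂ ⊆ Ioc 0 T := fun τ hτ => hIT (hIo.out hτ₁ hτ₂ hτ)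
  have hn' : 2 * (Nd : ℝ) * (τ₂ - τ₁) < (3 / 4 * ρ) ^ 2 := by
    have h1 : 2 * (Nd : ℝ) * (τ₂ - τ₁) ≤ 2 * (Nd : ℝ) * (κs * ρ ^ 2) :=
      mul_le_mul_of_nonneg_left hhi (by positivity)
    have h2 : 2 * (Nd : ℝ) * (κs * ρ ^ 2) = (2 * (Nd : ℝ) * κs) * ρ ^ 2 := by ring
    have h3 : (2 * (Nd : ℝ) * κs) * ρ ^ 2 ≤ 9 / 32 * ρ ^ 2 :=
      mul_le_mul_of_nonneg_right hκsN hρ2.le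
    have h4 : (3 / 4 * ρ) ^ 2 = 9 / 16 * ρ ^ 2 := by ring
    linarith
  have hposz : ∀ τ ∈ Icc τ₁ τ₂, ∀ x ∈ closedBall z ρ, 0 ≤ u τ x := fun τ hτ x hx =>
    hpos τ (hIo.out hτ₁ hτ₂ hτ) x (hzV hx)
  have key := hw.inf_step hΩ hA hρ hS' hτ12 (hzV.trans hVΩ) hn' hposz hμ hμu y hy
  -- the profile at age `τ₂ - τ₁ = κ ρ²`
  have hbr : c₀ ≤ ρ ^ Nd * (kSubLow Nd A (5 / 8 * ρ) (τ₂ - τ₁) -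
      gaussTail Nd (3 / 4 * ρ) (τ₂ - τ₁)) := by
    have e : τ₂ - τ₁ = (τ₂ - τ₁) / ρ ^ 2 * ρ ^ 2 := by field_simp
    have := hc₀ ρ ⟨hρ, hρ₀⟩ ((τ₂ - τ₁) / ρ ^ 2)
      ⟨(le_div_iff₀ hρ2).2 hlo, (div_le_iff₀ hρ2).2 hhi⟩
    rwa [← e] at this
  calc c₀ * (volume (ball (0 : E) 1)).toReal * (1 / 8) ^ Nd * μ
      = μ * (volume (ball (0 : E) 1)).toReal * (1 / 8) ^ Nd * c₀ := by ring
    _ ≤ μ * (volume (ball (0 : E) 1)).toReal * (1 / 8) ^ Nd *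
        (ρ ^ Nd * (kSubLow Nd A (5 / 8 * ρ) (τ₂ - τ₁) - gaussTail Nd (3 / 4 * ρ) (τ₂ - τ₁))) :=
      mul_le_mul_of_nonneg_left hbr (by positivity)
    _ = μ * (volume (ball (0 : E) 1)).toReal * (ρ / 8) ^ Nd *
        (kSubLow Nd A (5 / 8 * ρ) (τ₂ - τ₁) - gaussTail Nd (3 / 4 * ρ) (τ₂ - τ₁)) := by
      rw [div_eq_mul_one_div ρ 8, mul_pow]
      ring
    _ ≤ u τ₂ y := key

/-- **Mass of a small ball bounded by a later point value.** In the setting of `chain_step`,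
with `V` convex and `N ≥ 1` steps: if `B̄(c_p, ρ), B̄(x, ρ) ⊆ V`, `dist x c_p ≤ Nρ/4`, `τ, t ∈ I`
and `(N+1)κ₁ρ² ≤ t − τ ≤ κ₁ρ² + Nκsρ²`, then
`∫_{B(c_p, ρ/8)} u(τ) ≤ ρⁿ/(c₀ Λᴺ) · u(t, x)`, `Λ = c₀ |B(0,1)| 8⁻ⁿ`
(`mass_to_pointwise` for the first step of age `κ₁ρ²`, then `chain_lower_bound`). [cite: Lieberman1996, Ch. VI Thm 6.18, Cor 6.24, Thm 6.25 (chaining)] -/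
theorem IsDriftHeatSolutionOn.mass_le_of_chain (hw : IsDriftHeatSolutionOn a u A (Ioc 0 T) Ω)
    (hΩ : IsOpen Ω) (hA : 0 ≤ A) {V : Set E} {I : Set ℝ} (hV : Convex ℝ V) (hVΩ : V ⊆ Ω)
    (hIT : I ⊆ Ioc 0 T) (hIo : I.OrdConnected) (hpos : ∀ τ ∈ I, ∀ z ∈ V, 0 ≤ u τ z)
    {ρ ρ₀ κ₁ κs c₀ : ℝ} (hρ : 0 < ρ) (hρ₀ : ρ ≤ ρ₀) (hκ₁ : 0 < κ₁) (hc₀0 : 0 < c₀)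
    (hκsN : 2 * (Module.finrank ℝ E : ℝ) * κs ≤ 9 / 32)
    (hc₀ : ∀ ρ' ∈ Ioc 0 ρ₀, ∀ κ ∈ Icc κ₁ κs, c₀ ≤ ρ' ^ Module.finrank ℝ E *
      (kSubLow (Module.finrank ℝ E) A (5 / 8 * ρ') (κ * ρ' ^ 2) -
        gaussTail (Module.finrank ℝ E) (3 / 4 * ρ') (κ * ρ' ^ 2)))
    {N : ℕ} (hN : 0 < N) {cp x : E} (hcp : closedBall cp ρ ⊆ V) (hx : closedBall x ρ ⊆ V)
    (hdist : dist x cp ≤ N * (ρ / 4)) {τ t : ℝ} (hτ : τ ∈ I) (ht : t ∈ I)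
    (hlow : (N + 1) * (κ₁ * ρ ^ 2) ≤ t - τ) (hup : t - τ ≤ κ₁ * ρ ^ 2 + N * (κs * ρ ^ 2)) :
    ∫ z in ball cp (ρ / 8), u τ z ≤ ρ ^ Module.finrank ℝ E /
      (c₀ * (c₀ * (volume (ball (0 : E) 1)).toReal * (1 / 8) ^ Module.finrank ℝ E) ^ N) *
        u t x := by
  set Nd : ℕ := Module.finrank ℝ E with hNd
  set v₁ : ℝ := (volume (ball (0 : E) 1)).toReal with hv₁
  set Λ : ℝ := c₀ * v₁ * (1 / 8) ^ Nd with hΛ_def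
  have hn0 : (0 : ℝ) ≤ (Nd : ℝ) := Nat.cast_nonneg _
  have hv₁0 : 0 < v₁ :=
    ENNReal.toReal_pos (measure_ball_pos volume (0 : E) one_pos).ne' measure_ball_lt_top.ne
  have hΛ : 0 < Λ := by positivity
  have hρ2 : 0 < ρ ^ 2 := by positivity
  have hρN : 0 < ρ ^ Nd := by positivity
  have hNr : (0 : ℝ) < N := Nat.cast_pos.2 hN
  have hκ₁s : κ₁ ≤ κs := by
    -- the window is nonempty because `hlow`/`hup` are compatible
    have h1 : (N : ℝ) * ρ ^ 2 * κ₁ ≤ (N : ℝ) * ρ ^ 2 * κs := by linarith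
    exact le_of_mul_le_mul_left h1 (by positivity)
  -- the first step: from the mass at time `τ` to a lower bound at time `T₀ = τ + κ₁ρ²`
  set T₀ : ℝ := τ + κ₁ * ρ ^ 2 with hT₀
  have hτT₀ : τ < T₀ := by
    rw [hT₀]
    have := mul_pos hκ₁ hρ2
    linarith
  have hT₀t : T₀ ≤ t := by
    rw [hT₀]
    have : (0 : ℝ) ≤ N * (κ₁ * ρ ^ 2) := by positivity
    linarith
  have hT₀I : T₀ ∈ I := hIo.out hτ ht ⟨hτT₀.le, hT₀t⟩
  have hS' : Icc τ T₀ ⊆ Ioc 0 T := fun s hs => hIT (hIo.out hτ hT₀I hs)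
  have hn' : 2 * (Nd : ℝ) * (T₀ - τ) < (3 / 4 * ρ) ^ 2 := by
    have e : T₀ - τ = κ₁ * ρ ^ 2 := by rw [hT₀]; ring
    rw [e]
    have h1 : 2 * (Nd : ℝ) * (κ₁ * ρ ^ 2) ≤ 2 * (Nd : ℝ) * (κs * ρ ^ 2) :=
      mul_le_mul_of_nonneg_left (mul_le_mul_of_nonneg_right hκ₁s hρ2.le) (by positivity)
    have h2 : 2 * (Nd : ℝ) * (κs * ρ ^ 2) = (2 * (Nd : ℝ) * κs) * ρ ^ 2 := by ring
    have h3 : (2 * (Nd : ℝ) * κs) * ρ ^ 2 ≤ 9 / 32 * ρ ^ 2 :=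
      mul_le_mul_of_nonneg_right hκsN hρ2.le
    have h4 : (3 / 4 * ρ) ^ 2 = 9 / 16 * ρ ^ 2 := by ring
    linarith
  have hposc : ∀ s ∈ Icc τ T₀, ∀ z ∈ closedBall cp ρ, 0 ≤ u s z := fun s hs z hz =>
    hpos s (hIo.out hτ hT₀I hs) z (hcp hz)
  have hmass := hw.mass_to_pointwise hΩ hA hρ hS' hτT₀ (hcp.trans hVΩ) hn' hposc
  set m : ℝ := ∫ z in ball cp (ρ / 8), u τ z with hm
  have hm0 : 0 ≤ m := setIntegral_nonneg measurableSet_ball fun z hz =>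
    hpos τ hτ z (hcp (ball_subset_closedBall.trans (closedBall_subset_closedBall (by linarith)) hz))
  have hbr₁ : c₀ ≤ ρ ^ Nd * (kSubLow Nd A (5 / 8 * ρ) (T₀ - τ) -
      gaussTail Nd (3 / 4 * ρ) (T₀ - τ)) := by
    have e : T₀ - τ = κ₁ * ρ ^ 2 := by rw [hT₀]; ring
    rw [e]
    exact hc₀ ρ ⟨hρ, hρ₀⟩ κ₁ ⟨le_rfl, hκ₁s⟩
  have hμ₀ : ∀ y ∈ closedBall cp (ρ / 8), m * c₀ / ρ ^ Nd ≤ u T₀ y := by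
    intro y hy
    have hy3 : y ∈ closedBall cp (3 / 8 * ρ) := closedBall_subset_closedBall (by linarith) hy
    have h1 := hmass y hy3
    have h2 : m * c₀ / ρ ^ Nd ≤ m * (kSubLow Nd A (5 / 8 * ρ) (T₀ - τ) -
        gaussTail Nd (3 / 4 * ρ) (T₀ - τ)) := by
      rw [mul_div_assoc]
      exact mul_le_mul_of_nonneg_left ((div_le_iff₀ hρN).2 (by linarith [hbr₁])) hm0
    exact h2.trans h1
  -- the chain from `(cp, T₀)` to `(x, t)`
  have hchain := chain_lower_bound (u := u) hV hρ hκ₁.le hΛ.le hIo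
    (hw.chain_step hΩ hA hVΩ hIT hIo hpos hρ hρ₀ hκ₁ hκsN hc₀) hN hcp hx hdist hT₀I ht
    (by rw [hT₀]; linarith) (by rw [hT₀]; linarith) (by positivity) hμ₀
  -- rearrange
  have hΛN : 0 < Λ ^ N := pow_pos hΛ N
  have h1 : m * c₀ / ρ ^ Nd ≤ u t x / Λ ^ N := by
    rw [le_div_iff₀ hΛN]
    linarith [hchain]
  have h2 : m ≤ ρ ^ Nd / (c₀ * Λ ^ N) * u t x := by
    have := (div_le_iff₀ hρN).1 h1
    rw [show u t x / Λ ^ N * ρ ^ Nd = ρ ^ Nd / (c₀ * Λ ^ N) * u t x * c₀ by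
      field_simp] at this
    exact le_of_mul_le_mul_right this hc₀0
  exact h2

end MassChain

/-! ### Corollary 6.24 with `σ = 1` -/

section WeakHarnack

variable (E)

/-- **Lieberman 1996, Corollary 6.24 (weak Harnack inequality with flexible cylinders) for
`uₜ + a·∇u − Δu = 0` with bounded measurable drift, `σ = 1` — proof of the vendored statement
`Lieberman1996_weak_harnack`.** Since the principal part is the Laplacian and the members of the
elementary solution class are classical in space, the printed Moser-iteration proof is replaced
by Gaussian comparison: cover `B(y₂, θ₂R)` by `M(E, θ₂, θ₃, θ₄)` balls of radius `ρ/8`,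
`ρ = cR`, `c = min(θ₃, θ₄/2)`; the mass of `u(τ, ·)` on each small ball is bounded by
`ρⁿ/(c₀Λᴺ) · u(t, x)` through one Gaussian-comparison step of age `κ₁ρ²` and a Harnack chain of
`N` steps along the segment to `x` inside the convex cylinder base (`mass_le_of_chain`, the
positivity window `exists_kernel_window` making all constants uniform in `R ≤ R₀`, the drift
bound and `k > 0`); summing over the cover and integrating in `τ` (Fubini) gives
`R^{-n-2} ∫_{Q(Y₂, θ₂R)} u ≤ θ₂² M cⁿ/(c₀Λᴺ) · u(t, x) ≤ C (u(t,x) + kR)`. [cite: Lieberman1996, Ch. VI Cor 6.24] -/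
theorem Lieberman1996_weak_harnack_holds : Lieberman1996_weak_harnack E := by
  intro A R₀ θ₁ θ₂ θ₃ θ₄ hR₀ hθ₁ hθ₂ hθ₃ hθ₄ hθ13
  -- the constants
  set A' : ℝ := max A 0 with hA'
  have hA'0 : 0 ≤ A' := le_max_right _ _
  set Nd : ℕ := Module.finrank ℝ E with hNd
  have hn0 : (0 : ℝ) ≤ (Nd : ℝ) := Nat.cast_nonneg _
  set c : ℝ := min θ₃ (θ₄ / 2) with hc_def
  have hc0 : 0 < c := lt_min hθ₃ (by positivity)
  have hcθ₃ : c ≤ θ₃ := min_le_left _ _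
  have hcθ₄ : c ≤ θ₄ / 2 := min_le_right _ _
  obtain ⟨κs, hκs0, hκs1, hκsN, hwin⟩ := exists_kernel_window Nd hA'0 (ρ₀ := c * R₀) (by positivity)
  obtain ⟨N, hN32, hNκ⟩ : ∃ N : ℕ, 32 / c ≤ N ∧ 32 / (κs * c ^ 2) ≤ N :=
    ⟨⌈max (32 / c) (32 / (κs * c ^ 2))⌉₊, (le_max_left _ _).trans (Nat.le_ceil _),
      (le_max_right _ _).trans (Nat.le_ceil _)⟩
  have hNr : (0 : ℝ) < N := lt_of_lt_of_le (by positivity) hN32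
  have hN0 : 0 < N := Nat.cast_pos.1 hNr
  have hN1 : (1 : ℝ) ≤ N := Nat.one_le_cast.2 hN0
  set κ₁ : ℝ := min κs (θ₃ / (4 * N * c ^ 2)) with hκ₁_def
  have hκ₁0 : 0 < κ₁ := lt_min hκs0 (by positivity)
  have hκ₁s : κ₁ ≤ κs := min_le_left _ _
  have hκ₁θ : κ₁ ≤ θ₃ / (4 * N * c ^ 2) := min_le_right _ _
  obtain ⟨c₀, hc₀0, hc₀⟩ := hwin κ₁ ⟨hκ₁0, hκ₁s⟩
  set v₁ : ℝ := (volume (ball (0 : E) 1)).toReal with hv₁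
  have hv₁0 : 0 < v₁ :=
    ENNReal.toReal_pos (measure_ball_pos volume (0 : E) one_pos).ne' measure_ball_lt_top.ne
  set Λ : ℝ := c₀ * v₁ * (1 / 8) ^ Nd with hΛ_def
  have hΛ0 : 0 < Λ := by positivity
  obtain ⟨P, hPnorm, hPcov⟩ := exists_finset_net_unitBall (E := E) (ε := c / (8 * θ₂))
    (by positivity)
  set K : ℝ := θ₂ ^ 2 * P.card * c ^ Nd * (1 / (c₀ * Λ ^ N)) with hK_def
  have hK0 : 0 ≤ K := by positivity
  have hθ₁1 : θ₁ ≤ 1 := by linarith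
  have hθ₁sq : θ₁ ^ 2 ≤ θ₁ := by
    rw [pow_two]
    exact mul_le_of_le_one_left hθ₁.le hθ₁1
  refine ⟨K + 1, by positivity, ?_⟩
  intro Ω T a u hΩ ham haA hu2 hDu hΔu hequ y₀ s₀ R k hR hRR₀ hk hB hs₀ hs₀T hpos y₁ s₁ y₂ s₂
    hy₁ hs₁ hy₂ hs₂ hgap hB₁ hT₁ hB₂ hT₂ t x ht hx
  -- the class with drift bound `A'`
  have hw : IsDriftHeatSolutionOn a u A' (Ioc 0 T) Ω :=
    { measurable_drift := ham
      norm_drift_le := fun τ hτ z hz => (haA τ hτ z hz).trans (le_max_left _ _)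
      contDiffOn := hu2
      continuousOn_fderiv := hDu
      continuousOn_laplacian := hΔu
      integral_eq := fun z hz s hs τ hτ hsτ => hequ z hz s τ hs.1 hsτ hτ.2 }
  have hR2 : 0 < R ^ 2 := by positivity
  set ρ : ℝ := c * R with hρ_def
  have hρ : 0 < ρ := by positivity
  have hρρ₀ : ρ ≤ c * R₀ := mul_le_mul_of_nonneg_left hRR₀ hc0.le
  have hρθ₃ : ρ ≤ θ₃ * R := mul_le_mul_of_nonneg_right hcθ₃ hR.le
  have hρθ₄ : ρ ≤ θ₄ / 2 * R := mul_le_mul_of_nonneg_right hcθ₄ hR.le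
  set V : Set E := ball y₀ (4 * R) with hV_def
  have hVΩ : V ⊆ Ω := ball_subset_closedBall.trans hB
  set I : Set ℝ := Ioo (s₀ - 16 * R ^ 2) s₀ with hI_def
  have hIT : I ⊆ Ioc 0 T := fun τ hτ => ⟨by linarith [hτ.1], hτ.2.le.trans hs₀T⟩
  have hposI : ∀ τ ∈ I, ∀ z ∈ V, 0 ≤ u τ z := hpos
  -- elementary facts about the parameters
  have hθ24 : θ₂ + θ₄ < 4 := by
    have h1 : ((θ₂ + θ₄) * R) ^ 2 < 16 * R ^ 2 := by linarith [hs₂.2, hT₂]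
    have h2 : (θ₂ + θ₄) ^ 2 < 4 ^ 2 := by
      rw [mul_pow] at h1
      have := lt_of_mul_lt_mul_right h1 hR2.le
      linarith
    exact (abs_lt_of_sq_lt_sq' h2 (by norm_num)).2
  have h13R : (θ₁ * R) ^ 2 ≤ ((θ₁ + θ₃) * R) ^ 2 :=
    pow_le_pow_left₀ (by positivity) (mul_le_mul_of_nonneg_right (by linarith) hR.le) 2
  have h24R : (θ₂ * R) ^ 2 ≤ ((θ₂ + θ₄) * R) ^ 2 :=
    pow_le_pow_left₀ (by positivity) (mul_le_mul_of_nonneg_right (by linarith) hR.le) 2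
  have h24R' : θ₂ * R < (θ₂ + θ₄) * R := mul_lt_mul_of_pos_right (by linarith) hR
  have h24Rs : (θ₂ * R) ^ 2 < ((θ₂ + θ₄) * R) ^ 2 :=
    pow_lt_pow_left₀ h24R' (by positivity) two_ne_zero
  -- the point `(t, x)` and the times
  have htI : t ∈ I := ⟨by linarith [ht.1], ht.2.trans hs₁.2⟩
  have hxV : closedBall x ρ ⊆ V := by
    intro w hw
    apply hB₁
    rw [mem_ball]
    calc dist w y₁ ≤ dist w x + dist x y₁ := dist_triangle _ _ _
      _ < ρ + θ₁ * R := add_lt_add_of_le_of_lt (mem_closedBall.1 hw) (mem_ball.1 hx)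
      _ ≤ (θ₁ + θ₃) * R := by linarith
  have hxV' : x ∈ V := hxV (mem_closedBall_self hρ.le)
  have hutx : 0 ≤ u t x := hposI t htI x hxV'
  -- the estimate of one time slice
  have slice : ∀ τ ∈ Ioo (s₂ - (θ₂ * R) ^ 2) s₂,
      ∫ z in ball y₂ (θ₂ * R), u τ z ≤ P.card * (ρ ^ Nd / (c₀ * Λ ^ N)) * u t x := by
    intro τ hτ
    have hτI : τ ∈ I := ⟨by linarith [hτ.1], hτ.2.trans hs₂.2⟩
    -- time budget between `τ` and `t`
    have hgap1 : θ₃ * R ^ 2 < t - τ := by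
      have h1 : s₁ - (θ₁ * R) ^ 2 < t := ht.1
      have h2 : τ < s₂ := hτ.2
      have e1 : (θ₁ * R) ^ 2 = θ₁ ^ 2 * R ^ 2 := by ring
      have e2 : θ₁ ^ 2 * R ^ 2 ≤ θ₁ * R ^ 2 := mul_le_mul_of_nonneg_right hθ₁sq hR2.le
      linarith
    have hgap2 : t - τ < 16 * R ^ 2 := by linarith [htI.2, hτI.1]
    have hlow : ((N : ℝ) + 1) * (κ₁ * ρ ^ 2) ≤ t - τ := by
      have h1 : κ₁ * (4 * N * c ^ 2) ≤ θ₃ := (le_div_iff₀ (by positivity)).1 hκ₁θ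
      have h3 : ((N : ℝ) + 1) * (κ₁ * ρ ^ 2) ≤ 2 * N * (κ₁ * ρ ^ 2) :=
        mul_le_mul_of_nonneg_right (by linarith) (by positivity)
      have h4 : 2 * (N : ℝ) * (κ₁ * ρ ^ 2) = (κ₁ * (4 * N * c ^ 2)) * R ^ 2 / 2 := by
        rw [hρ_def]; ring
      have h5 : (κ₁ * (4 * N * c ^ 2)) * R ^ 2 ≤ θ₃ * R ^ 2 := mul_le_mul_of_nonneg_right h1 hR2.le
      have h6 : 0 ≤ θ₃ * R ^ 2 := by positivity
      linarith
    have hup : t - τ ≤ κ₁ * ρ ^ 2 + N * (κs * ρ ^ 2) := by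
      have h1 : 32 ≤ N * (κs * c ^ 2) := (div_le_iff₀ (by positivity)).1 hNκ
      have h2 : (N : ℝ) * (κs * ρ ^ 2) = N * (κs * c ^ 2) * R ^ 2 := by rw [hρ_def]; ring
      have h3 : 0 ≤ κ₁ * ρ ^ 2 := by positivity
      have h4 : 32 * R ^ 2 ≤ N * (κs * c ^ 2) * R ^ 2 := mul_le_mul_of_nonneg_right h1 hR2.le
      linarith
    -- the small balls
    have hcen : ∀ p ∈ P, closedBall (y₂ + (θ₂ * R) • p) ρ ⊆ V := by
      intro p hp w hw
      apply hB₂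
      rw [mem_ball]
      have h1 : dist (y₂ + (θ₂ * R) • p) y₂ = θ₂ * R * ‖p‖ := by
        rw [dist_eq_norm, add_sub_cancel_left, norm_smul, Real.norm_of_nonneg (by positivity)]
      have h2 : θ₂ * R * ‖p‖ < θ₂ * R * (1 + c / (8 * θ₂)) :=
        mul_lt_mul_of_pos_left (hPnorm p hp) (by positivity)
      have h3 : θ₂ * R * (1 + c / (8 * θ₂)) = θ₂ * R + ρ / 8 := by rw [hρ_def]; field_simp
      calc dist w y₂ ≤ dist w (y₂ + (θ₂ * R) • p) + dist (y₂ + (θ₂ * R) • p) y₂ :=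
            dist_triangle _ _ _
        _ < ρ + (θ₂ * R + ρ / 8) := by
            rw [h1]; exact add_lt_add_of_le_of_lt (mem_closedBall.1 hw) (h2.trans_eq h3)
        _ ≤ (θ₂ + θ₄) * R := by
            have : 0 ≤ θ₄ * R := by positivity
            linarith
    have hmass : ∀ p ∈ P, ∫ z in ball (y₂ + (θ₂ * R) • p) (ρ / 8), u τ z ≤
        ρ ^ Nd / (c₀ * Λ ^ N) * u t x := by
      intro p hp
      have hdist : dist x (y₂ + (θ₂ * R) • p) ≤ N * (ρ / 4) := by
        have h1 : dist x (y₂ + (θ₂ * R) • p) < 8 * R := by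
          have hx0 : dist x y₀ < 4 * R := mem_ball.1 hxV'
          have hc0' : dist (y₂ + (θ₂ * R) • p) y₀ < 4 * R :=
            mem_ball.1 (hcen p hp (mem_closedBall_self hρ.le))
          calc dist x (y₂ + (θ₂ * R) • p) ≤ dist x y₀ + dist y₀ (y₂ + (θ₂ * R) • p) :=
                dist_triangle _ _ _
            _ < 4 * R + 4 * R := by rw [dist_comm y₀]; exact add_lt_add hx0 hc0'
            _ = 8 * R := by ring
        have h2 : 8 * R ≤ N * (ρ / 4) := by
          have h3 : 32 ≤ N * c := (div_le_iff₀ hc0).1 hN32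
          have h4 : 32 * R ≤ N * c * R := mul_le_mul_of_nonneg_right h3 hR.le
          rw [hρ_def]
          linarith
        exact h1.le.trans h2
      exact hw.mass_le_of_chain hΩ hA'0 (convex_ball y₀ (4 * R)) hVΩ hIT ordConnected_Ioo hposI
        hρ hρρ₀ hκ₁0 hc₀0 hκsN hc₀ hN0 (hcen p hp) hxV hdist hτI htI hlow hup
    -- summing over the cover
    have hcov : ∀ z ∈ ball y₂ (θ₂ * R), ∃ p ∈ P, z ∈ ball (y₂ + (θ₂ * R) • p) (ρ / 8) := by
      intro z hz
      obtain ⟨p, hp, hzp⟩ := exists_near_center_of_mem_ball hPcov (by positivity) hz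
      refine ⟨p, hp, mem_ball.2 (hzp.trans_eq ?_)⟩
      rw [hρ_def]
      field_simp
    have huτ : ContinuousOn (u τ) Ω := (hw.contDiffOn τ (hIT hτI)).continuousOn
    have hintV : IntegrableOn (u τ) V volume :=
      ((huτ.mono hB).integrableOn_compact (isCompact_closedBall y₀ (4 * R))).mono_set
        ball_subset_closedBall
    have hsum := setIntegral_ball_le_sum_of_cover (f := u τ) (cen := fun p => y₂ + (θ₂ * R) • p)
      hcov
      (fun p hp z hz => hposI τ hτI z (hcen p hp (ball_subset_closedBall.trans
        (closedBall_subset_closedBall (by linarith)) hz)))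
      (fun p hp => hintV.mono_set ((ball_subset_closedBall.trans
        (closedBall_subset_closedBall (by linarith))).trans (hcen p hp)))
      (hintV.mono_set ((ball_subset_ball h24R'.le).trans hB₂))
    calc ∫ z in ball y₂ (θ₂ * R), u τ z
        ≤ ∑ p ∈ P, ∫ z in ball (y₂ + (θ₂ * R) • p) (ρ / 8), u τ z := hsum
      _ ≤ ∑ p ∈ P, ρ ^ Nd / (c₀ * Λ ^ N) * u t x := Finset.sum_le_sum hmass
      _ = P.card * (ρ ^ Nd / (c₀ * Λ ^ N)) * u t x := by
          rw [Finset.sum_const, nsmul_eq_mul]; ring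
  -- integrating the slice estimate in time (Fubini)
  set Q : Set (ℝ × E) := Ioo (s₂ - (θ₂ * R) ^ 2) s₂ ×ˢ ball y₂ (θ₂ * R) with hQ
  have hcontu : ContinuousOn (uncurry u) (Icc (s₂ - (θ₂ * R) ^ 2) s₂ ×ˢ Ω) :=
    hw.continuousOn_uncurry hΩ fun τ hτ => hIT ⟨by linarith [hτ.1, hs₂.1], hτ.2.trans_lt hs₂.2⟩
  have hintQ : IntegrableOn (fun p : ℝ × E => u p.1 p.2) Q (volume.prod volume) := by
    have hK : IsCompact (Icc (s₂ - (θ₂ * R) ^ 2) s₂ ×ˢ closedBall y₂ (θ₂ * R)) :=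
      isCompact_Icc.prod (isCompact_closedBall _ _)
    have hsub : Icc (s₂ - (θ₂ * R) ^ 2) s₂ ×ˢ closedBall y₂ (θ₂ * R) ⊆
        Icc (s₂ - (θ₂ * R) ^ 2) s₂ ×ˢ Ω :=
      prod_mono le_rfl ((closedBall_subset_ball h24R').trans (hB₂.trans hVΩ))
    have h1 : IntegrableOn (fun p : ℝ × E => u p.1 p.2)
        (Icc (s₂ - (θ₂ * R) ^ 2) s₂ ×ˢ closedBall y₂ (θ₂ * R)) (volume.prod volume) :=
      (hcontu.mono hsub).integrableOn_compact hK
    exact h1.mono_set (prod_mono Ioo_subset_Icc_self ball_subset_closedBall)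
  have hfub : (∫ p in Q, u p.1 p.2) =
      ∫ τ in Ioo (s₂ - (θ₂ * R) ^ 2) s₂, ∫ z in ball y₂ (θ₂ * R), u τ z := by
    rw [Measure.volume_eq_prod, hQ]
    exact setIntegral_prod (fun p : ℝ × E => u p.1 p.2) hintQ
  have hinner : IntegrableOn (fun τ => ∫ z in ball y₂ (θ₂ * R), u τ z)
      (Ioo (s₂ - (θ₂ * R) ^ 2) s₂) volume := by
    have h1 : Integrable (fun p : ℝ × E => u p.1 p.2)
        ((volume.restrict (Ioo (s₂ - (θ₂ * R) ^ 2) s₂)).prod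
          (volume.restrict (ball y₂ (θ₂ * R)))) := by
      rw [Measure.prod_restrict]; exact hintQ
    exact h1.integral_prod_left
  have hτint : (∫ τ in Ioo (s₂ - (θ₂ * R) ^ 2) s₂, ∫ z in ball y₂ (θ₂ * R), u τ z) ≤
      ∫ τ in Ioo (s₂ - (θ₂ * R) ^ 2) s₂, P.card * (ρ ^ Nd / (c₀ * Λ ^ N)) * u t x :=
    setIntegral_mono_on hinner (integrableOn_const measure_Ioo_lt_top.ne) measurableSet_Ioo slice
  have hconst : (∫ τ in Ioo (s₂ - (θ₂ * R) ^ 2) s₂, P.card * (ρ ^ Nd / (c₀ * Λ ^ N)) * u t x) =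
      (θ₂ * R) ^ 2 * (P.card * (ρ ^ Nd / (c₀ * Λ ^ N)) * u t x) := by
    rw [setIntegral_const, measureReal_def, Real.volume_Ioo,
      ENNReal.toReal_ofReal (by linarith [sq_nonneg (θ₂ * R)]), smul_eq_mul]
    ring
  have hQle : (∫ p in Q, u p.1 p.2) ≤ K * R ^ (Nd + 2) * u t x := by
    rw [hfub]
    refine (hτint.trans_eq hconst).trans (le_of_eq ?_)
    rw [hK_def, hρ_def, mul_pow, pow_add]
    ring
  -- conclusion
  have hRpow : 0 < R ^ (Nd + 2) := by positivity
  calc (R ^ (Nd + 2))⁻¹ * ∫ p in Q, u p.1 p.2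
      ≤ (R ^ (Nd + 2))⁻¹ * (K * R ^ (Nd + 2) * u t x) :=
        mul_le_mul_of_nonneg_left hQle (by positivity)
    _ = K * u t x := by field_simp
    _ ≤ (K + 1) * (u t x + k * R) := by
        have h1 : 0 ≤ k * R := by positivity
        have h2 : 0 ≤ K * (k * R) := mul_nonneg hK0 h1
        linarith

end WeakHarnack

end Literature.Analysis.FluidPDE

end
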